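import Summits.CriticalPhenomena.PercolationContinuityZ3.Theorems.PercNearOneGluingNoHeavyLowerTailSahiCombMixSingleOrPrelim
import Summits.CriticalPhenomena.PercolationContinuityZ3.Theorems.PercNearOneGluingNoHeavyLowerTailSahiCombMixMixedCells
import Summits.CriticalPhenomena.PercolationContinuityZ3.Theorems.PercNearOneGluingNoHeavyLowerTailSahiMixtureHereditary
import Summits.CriticalPhenomena.PercolationContinuityZ3.Theorems.SahiMasterFamilyBlockStratum

/-!
# The comb hierarchy for Sahi's `E_k`, LXXIII: single-member H-MIX at the LAW level — slots, defect sets and defect moments of the mixed coin family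
# (ingredients; the theorem is in `…SahiMixtureSingleOrLaw`)

Support file of the one-cut programme (crux `NoHeavyLowerTail`, stmt-CriticalPhenomena-4575; cell `prim-masterthm`, seat P3, gen 11;
`run/shared/lean/prim/prim-masterthm/prim-masterthm-p3/HIERARCHY.md` §19, memo `run/shared/lean/prim/prim-masterthm/FROM-prim-masterthm-p3-g11-SINGLE-MEMBER-OR.md`).
The abstract-law version of `…SahiCombMixSingleOrAll/Mixed` (which treat product measures on cubes): `μ ≥ 0` a weight on a finite type `α`, events `A_0,…,A_{n−1}`
with `HereditaryAllOrders μ A` (`𝒦`), an independent coin of bias `h` (`coinWeight μ h` on `α × Bool`) OR-ed into `A_i` and AND-ed into the members `F ∌ i`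
(`orAndCoin (A l) (sel i l) (F l)`).  For EVERY row of the ∩-closed family of the mixed events, `h ↦ E_m(μ ⊗ coin(h); slots)` is BERNSTEIN-POSITIVE of degree
`m` — in particular the mixed family is in `𝒦` for every `h ∈ [0,1]`.  Same touched-set recursion as on the cube (`SahiMomentExpansion.sahiE_cons_eq_moment_expansion_aux`
with the defect indicator `1_{Φ}`, `Φ = {(a,ξ) | a ∈ Q ∖ A_i, ξ = false}`, at the head; `Φ` kills every other active slot); bases: gen 6's AND theorem
`hereditary_andCoin_bernsteinPos` (no OR-touched slot) and the affine cell (one OR-touched slot, nothing else active).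
* **`hereditary_orAndCoin_single_bernsteinPos`**, `hereditaryAllOrders_orAndCoin_single`; pure OR: **`hereditaryAllOrders_orCoin_single`** — `(A_0,…,A_{n−1}) ∈ 𝒦`,
  `H` independent ⇒ `(A_0,…,A_i ∪ H,…,A_{n−1}) ∈ 𝒦`, every `n` (the `|F| = 1` rung of H-MIX(n) is TRUE for all `n`; `|F| = 2` is false at `n = 5`,
  `not_hereditaryMixturePositivity_five`).
HONEST FRAMING: a closure property of the hereditary class; nothing here asserts (M⁺-k) or `C_k` for `k ≥ 3`. [this work]
-/

noncomputable section

open scoped Classical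

namespace Summit.CriticalPhenomena.PercolationContinuityZ3.Theorems

open Finset Function
open Literature.Combinatorics.Sahi2008
open Literature.Probability.Percolation.BHK2006 (ind_le_one ind_inter)
open Literature.Probability.Percolation.DecisionTree (ind ind_of_mem ind_of_not_mem ind_nonneg)
open SahiComb
open SahiCombMix (sel orAndCoin finsetProd_ind_eq_ind_biInter ind_empty_fun ex_zero_fun card_filter_succAbove)
open scoped Nat

namespace SahiMixture

section SingleOrLaw

variable {α : Type*} [Fintype α] (μ : α → ℝ) {n : ℕ} (A : Fin n → Set α) (i : Fin n) (F : Fin n → Bool) (hF : F i = false)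

/-! ### Slots of the mixed coin family -/

omit [Fintype α] in
/-- Membership in a mixed member other than the OR-ed one. [this work] -/
theorem mem_orAndCoin_sel_ne {l : Fin n} (hli : l ≠ i) (x : α × Bool) :
    x ∈ orAndCoin (A l) (sel i l) (F l) ↔ x.1 ∈ A l ∧ (F l = true → x.2 = true) := by
  unfold SahiCombMix.orAndCoin
  have hs : sel i l = false := by simp [sel, hli]
  rw [hs]
  cases F l <;> simp [orCoin, andCoin]

omit [Fintype α] in
/-- Membership in the OR-ed member. [this work] -/
theorem mem_orAndCoin_sel_self (x : α × Bool) : x ∈ orAndCoin (A i) (sel i i) (F i) ↔ x.1 ∈ A i ∨ x.2 = true := by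
  unfold SahiCombMix.orAndCoin
  have hs : sel i i = true := by simp [sel]
  rw [hs]
  simp [orCoin]

omit [Fintype α] in
/-- Over an index set without AND-ed members and without `i`: the cylinder over the old member. [this work] -/
theorem slotLaw_plain (K : Finset (Fin n)) (hi : i ∉ K) (h : ∀ l ∈ K, l ≠ i → F l = false) :
    (⋂ l ∈ K, orAndCoin (A l) (sel i l) (F l)) = {x : α × Bool | x.1 ∈ ⋂ l ∈ K, A l} := by
  ext x
  simp only [Set.mem_iInter, Set.mem_setOf_eq]
  refine forall_congr' fun l => forall_congr' fun hl => ?_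
  have hli : l ≠ i := fun h' => hi (h' ▸ hl)
  rw [mem_orAndCoin_sel_ne A i F hli, h l hl hli]
  simp

omit [Fintype α] in
/-- Membership in an OR-touched slot (`i ∈ K`, no AND-ed member). [this work] -/
theorem mem_slotLaw_touched (K : Finset (Fin n)) (hi : i ∈ K) (h : ∀ l ∈ K, l ≠ i → F l = false) (x : α × Bool) :
    x ∈ (⋂ l ∈ K, orAndCoin (A l) (sel i l) (F l)) ↔ (x.1 ∈ ⋂ l ∈ K.erase i, A l) ∧ (x.1 ∈ A i ∨ x.2 = true) := by
  conv_lhs => rw [← Finset.insert_erase hi, Finset.set_biInter_insert]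
  rw [Set.mem_inter_iff, and_comm, mem_orAndCoin_sel_self]
  refine and_congr ?_ Iff.rfl
  simp only [Set.mem_iInter]
  refine forall_congr' fun l => forall_congr' fun hl => ?_
  have hli : l ≠ i := Finset.ne_of_mem_erase hl
  rw [mem_orAndCoin_sel_ne A i F hli, h l (Finset.mem_of_mem_erase hl) hli]
  simp

omit [Fintype α] in
/-- The indicator of an OR-touched slot: `1_{slot} = 1_{cyl Q} − 1_{Φ}`, `Q = ⋂_{K∖i} A`, `Φ = {(a, false) | a ∈ Q ∖ A_i}`. [this work] -/
theorem ind_slotLaw_touched (K : Finset (Fin n)) (hi : i ∈ K) (h : ∀ l ∈ K, l ≠ i → F l = false) :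
    ind (⋂ l ∈ K, orAndCoin (A l) (sel i l) (F l))
      = ind {x : α × Bool | x.1 ∈ ⋂ l ∈ K.erase i, A l} - ind {x : α × Bool | (x.1 ∈ (⋂ l ∈ K.erase i, A l) ∧ x.1 ∉ A i) ∧ x.2 = false} := by
  have hmem := mem_slotLaw_touched A i F K hi h
  funext x
  rw [Pi.sub_apply]
  by_cases hQ : x.1 ∈ ⋂ l ∈ K.erase i, A l
  · by_cases hA : x.1 ∈ A i
    · rw [ind_of_mem ((hmem x).2 ⟨hQ, Or.inl hA⟩), ind_of_mem (show x ∈ {x : α × Bool | x.1 ∈ ⋂ l ∈ K.erase i, A l} from hQ),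
        ind_of_not_mem (show x ∉ {x : α × Bool | (x.1 ∈ (⋂ l ∈ K.erase i, A l) ∧ x.1 ∉ A i) ∧ x.2 = false} from fun h' => h'.1.2 hA)]
      ring
    · by_cases hb : x.2 = true
      · rw [ind_of_mem ((hmem x).2 ⟨hQ, Or.inr hb⟩), ind_of_mem (show x ∈ {x : α × Bool | x.1 ∈ ⋂ l ∈ K.erase i, A l} from hQ),
          ind_of_not_mem (show x ∉ {x : α × Bool | (x.1 ∈ (⋂ l ∈ K.erase i, A l) ∧ x.1 ∉ A i) ∧ x.2 = false} from fun h' => by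
            have h2 := h'.2; rw [hb] at h2; exact Bool.noConfusion h2)]
        ring
      · have hb' : x.2 = false := by simpa using hb
        rw [ind_of_not_mem (fun h' => ((hmem x).1 h').2.elim hA hb), ind_of_mem (show x ∈ {x : α × Bool | x.1 ∈ ⋂ l ∈ K.erase i, A l} from hQ),
          ind_of_mem (show x ∈ {x : α × Bool | (x.1 ∈ (⋂ l ∈ K.erase i, A l) ∧ x.1 ∉ A i) ∧ x.2 = false} from ⟨⟨hQ, hA⟩, hb'⟩)]
        ring
  · rw [ind_of_not_mem (fun h' => hQ ((hmem x).1 h').1), ind_of_not_mem (show x ∉ {x : α × Bool | x.1 ∈ ⋂ l ∈ K.erase i, A l} from hQ),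
      ind_of_not_mem (show x ∉ {x : α × Bool | (x.1 ∈ (⋂ l ∈ K.erase i, A l) ∧ x.1 ∉ A i) ∧ x.2 = false} from fun h' => hQ h'.1.1)]
    ring

omit [Fintype α] in
include hF in
/-- An AND-type slot (an AND-ed member in `K`) lies on the coin: `{(a, true) | a ∈ ⋂_{K∖i} A}`. [this work] -/
theorem slotLaw_and (K : Finset (Fin n)) (h : ∃ l ∈ K, F l = true) :
    (⋂ l ∈ K, orAndCoin (A l) (sel i l) (F l)) = {x : α × Bool | (x.1 ∈ ⋂ l ∈ K.erase i, A l) ∧ x.2 = true} := by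
  obtain ⟨l₀, hl₀, hF₀⟩ := h
  have hl₀i : l₀ ≠ i := fun h' => by rw [h', hF] at hF₀; exact Bool.false_ne_true hF₀
  ext x
  simp only [Set.mem_iInter, Set.mem_setOf_eq, Finset.mem_erase]
  constructor
  · intro hx
    have hb : x.2 = true := ((mem_orAndCoin_sel_ne A i F hl₀i x).1 (hx l₀ hl₀)).2 hF₀
    refine ⟨fun l hl => ?_, hb⟩
    exact ((mem_orAndCoin_sel_ne A i F hl.1 x).1 (hx l hl.2)).1
  · rintro ⟨hx, hb⟩ l hl
    by_cases hli : l = i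
    · subst hli; exact (mem_orAndCoin_sel_self A l F x).2 (Or.inr hb)
    · exact (mem_orAndCoin_sel_ne A i F hli x).2 ⟨hx l ⟨hli, hl⟩, fun _ => hb⟩

omit [Fintype α] in
include hF in
/-- The defect set misses every ACTIVE slot (OR-touched or AND-type). [this work] -/
theorem phiLaw_inter_active (K K' : Finset (Fin n)) (hact : i ∈ K' ∨ ∃ l ∈ K', F l = true) :
    {x : α × Bool | (x.1 ∈ (⋂ l ∈ K.erase i, A l) ∧ x.1 ∉ A i) ∧ x.2 = false} ∩ (⋂ l ∈ K', orAndCoin (A l) (sel i l) (F l)) = ∅ := by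
  refine Set.eq_empty_iff_forall_notMem.2 fun x hx => ?_
  by_cases hA : ∃ l ∈ K', F l = true
  · rw [slotLaw_and A i F hF K' hA] at hx
    have h1 := hx.1.2; have h2 := hx.2.2
    rw [h1] at h2; exact Bool.false_ne_true h2
  · have hi : i ∈ K' := hact.resolve_right hA
    have hx2 := (Set.mem_iInter₂.1 hx.2) i hi
    rcases (mem_orAndCoin_sel_self A i F x).1 hx2 with h' | h'
    · exact hx.1.1.2 h'
    · have h1 := hx.1.2; rw [h1] at h'; exact Bool.false_ne_true h'

/-- **Moments against the defect set**: `E_{μ⊗coin(h)}[1_{Φ ∩ cyl S}] = (1 − h)·μ((Q ∩ S) ∖ A_i)`. [this work] -/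
theorem ex_coin_phiLaw_inter (K : Finset (Fin n)) (S : Set α) (h : ℝ) :
    ex (coinWeight μ h) (ind ({x : α × Bool | (x.1 ∈ (⋂ l ∈ K.erase i, A l) ∧ x.1 ∉ A i) ∧ x.2 = false} ∩ {x : α × Bool | x.1 ∈ S}))
      = (1 - h) * ex μ (ind (((⋂ l ∈ K.erase i, A l) ∩ S) \ A i)) := by
  rw [ex_coinWeight]
  have ht : (fun a => ind ({x : α × Bool | (x.1 ∈ (⋂ l ∈ K.erase i, A l) ∧ x.1 ∉ A i) ∧ x.2 = false} ∩ {x : α × Bool | x.1 ∈ S}) (a, true))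
      = fun _ => 0 := by
    funext a
    exact ind_of_not_mem fun h' => Bool.noConfusion h'.1.2
  have hf : (fun a => ind ({x : α × Bool | (x.1 ∈ (⋂ l ∈ K.erase i, A l) ∧ x.1 ∉ A i) ∧ x.2 = false} ∩ {x : α × Bool | x.1 ∈ S}) (a, false))
      = ind (((⋂ l ∈ K.erase i, A l) ∩ S) \ A i) := by
    funext a
    by_cases ha : a ∈ ((⋂ l ∈ K.erase i, A l) ∩ S) \ A i
    · rw [ind_of_mem ha]
      exact ind_of_mem (show ((a, false) : α × Bool) ∈
        ({x : α × Bool | (x.1 ∈ (⋂ l ∈ K.erase i, A l) ∧ x.1 ∉ A i) ∧ x.2 = false} ∩ {x : α × Bool | x.1 ∈ S}) from ⟨⟨⟨ha.1.1, ha.2⟩, rfl⟩, ha.1.2⟩)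
    · rw [ind_of_not_mem ha]
      exact ind_of_not_mem (show ((a, false) : α × Bool) ∉
        ({x : α × Bool | (x.1 ∈ (⋂ l ∈ K.erase i, A l) ∧ x.1 ∉ A i) ∧ x.2 = false} ∩ {x : α × Bool | x.1 ∈ S}) from
        fun h' => ha ⟨⟨h'.1.1.1, h'.2⟩, h'.1.1.2⟩)
  rw [ht, hf, show ex μ (fun _ : α => (0 : ℝ)) = 0 from by simp [ex_def]]
  ring

/-- Coin rows of cylinder slots are the old rows (the coin integrates out). [folklore] -/
theorem sahiE_coinWeight_cyl {μ : α → ℝ} (hμ1 : ∑ a, μ a = 1) (h : ℝ) :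
    ∀ (m : ℕ) (g : Fin m → α → ℝ), sahiE (coinWeight μ h) m (fun j => fun x : α × Bool => g j x.1) = sahiE μ m g
  | 0, g => by rw [sahiE_zero, sahiE_zero]
  | 1, g => by
    rw [sahiE_one_apply, sahiE_one_apply, ex_coinWeight]
    ring
  | m + 2, g => by
    rw [sahiE_succ_succ, sahiE_succ_succ]
    have h0 : ex (coinWeight μ h) ((fun j => fun x : α × Bool => g j x.1) 0) = ex μ (g 0) := by
      rw [ex_coinWeight]; ring
    have ht2 : sahiE (coinWeight μ h) (m + 1) (Fin.tail (fun j => fun x : α × Bool => g j x.1)) = sahiE μ (m + 1) (Fin.tail g) :=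
      sahiE_coinWeight_cyl hμ1 h (m + 1) (Fin.tail g)
    have htail : ∀ k : Fin (m + 1), sahiE (coinWeight μ h) (m + 1)
        (update (Fin.tail (fun j => fun x : α × Bool => g j x.1)) k
          (Fin.tail (fun j => fun x : α × Bool => g j x.1) k * (fun j => fun x : α × Bool => g j x.1) 0))
        = sahiE μ (m + 1) (update (Fin.tail g) k (Fin.tail g k * g 0)) := by
      intro k
      have hu : update (Fin.tail (fun j => fun x : α × Bool => g j x.1)) k
            (Fin.tail (fun j => fun x : α × Bool => g j x.1) k * (fun j => fun x : α × Bool => g j x.1) 0)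
          = fun j => fun x : α × Bool => (update (Fin.tail g) k (Fin.tail g k * g 0)) j x.1 := by
        funext j x
        by_cases hj : j = k
        · subst hj; simp only [update_self, Fin.tail, Pi.mul_apply]
        · simp only [update_of_ne hj, Fin.tail]
      rw [hu]
      exact sahiE_coinWeight_cyl hμ1 h (m + 1) _
    rw [h0, ht2]
    simp only [htail]

/-! ### The recursion's defect moments and the induction -/

omit [Fintype α] in
/-- Cylinder indicators factor through the first coordinate. [folklore] -/
theorem ind_cyl (S : Set α) : ind {x : α × Bool | x.1 ∈ S} = fun x : α × Bool => ind S x.1 := by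
  funext x
  by_cases hx : x.1 ∈ S
  · rw [ind_of_mem (show x ∈ {x : α × Bool | x.1 ∈ S} from hx), ind_of_mem hx]
  · rw [ind_of_not_mem (show x ∉ {x : α × Bool | x.1 ∈ S} from hx), ind_of_not_mem hx]

include hF in
/-- **Defect moments of the recursion (law level)**: for an OR-touched slot `x` and a set `T` of other slots, `E[1_{Φ_x}·Π_{j∈T} 1_{slot_j}]` vanishes if `T` contains an
active slot and equals `(1 − h)·μ((Q_x ∩ Q_T) ∖ A_i)` otherwise. [this work] -/
theorem ex_phiLaw_prod {m : ℕ} (K : Fin (m + 1) → Finset (Fin n)) (x : Fin (m + 1)) (T : Finset (Fin m)) (h : ℝ) :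
    ex (coinWeight μ h) (ind {y : α × Bool | (y.1 ∈ (⋂ l ∈ (K x).erase i, A l) ∧ y.1 ∉ A i) ∧ y.2 = false}
        * ∏ j ∈ T, ind (⋂ l ∈ K (x.succAbove j), orAndCoin (A l) (sel i l) (F l)))
      = if ∃ y ∈ T, (i ∈ K (x.succAbove y) ∨ ∃ l ∈ K (x.succAbove y), F l = true) then 0 else
        (1 - h) * ex μ (ind (((⋂ l ∈ (K x).erase i, A l) ∩ ⋂ j ∈ T, ⋂ l ∈ K (x.succAbove j), A l) \ A i)) := by
  rw [finsetProd_ind_eq_ind_biInter (fun j => ⋂ l ∈ K (x.succAbove j), orAndCoin (A l) (sel i l) (F l)) T,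
    show ind {y : α × Bool | (y.1 ∈ (⋂ l ∈ (K x).erase i, A l) ∧ y.1 ∉ A i) ∧ y.2 = false}
        * ind (⋂ j ∈ T, ⋂ l ∈ K (x.succAbove j), orAndCoin (A l) (sel i l) (F l))
      = ind ({y : α × Bool | (y.1 ∈ (⋂ l ∈ (K x).erase i, A l) ∧ y.1 ∉ A i) ∧ y.2 = false}
          ∩ ⋂ j ∈ T, ⋂ l ∈ K (x.succAbove j), orAndCoin (A l) (sel i l) (F l))
      from by funext ω; rw [Pi.mul_apply]; exact (ind_inter _ _ ω).symm]
  split_ifs with hT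
  · obtain ⟨y, hyT, hy⟩ := hT
    have hsub : {z : α × Bool | (z.1 ∈ (⋂ l ∈ (K x).erase i, A l) ∧ z.1 ∉ A i) ∧ z.2 = false}
          ∩ (⋂ j ∈ T, ⋂ l ∈ K (x.succAbove j), orAndCoin (A l) (sel i l) (F l))
        ⊆ {z : α × Bool | (z.1 ∈ (⋂ l ∈ (K x).erase i, A l) ∧ z.1 ∉ A i) ∧ z.2 = false}
          ∩ (⋂ l ∈ K (x.succAbove y), orAndCoin (A l) (sel i l) (F l)) :=
      Set.inter_subset_inter_right _ fun ω hω => (Set.mem_iInter₂.1 hω) y hyT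
    rw [phiLaw_inter_active A i F hF (K x) _ hy, Set.subset_empty_iff] at hsub
    rw [hsub, ind_empty_fun, ex_zero_fun]
  · have hun : ∀ y ∈ T, i ∉ K (x.succAbove y) ∧ ∀ l ∈ K (x.succAbove y), l ≠ i → F l = false := by
      intro y hy
      refine ⟨fun hi => hT ⟨y, hy, Or.inl hi⟩, fun l hl _ => ?_⟩
      cases hFl : F l
      · rfl
      · exact absurd ⟨y, hy, Or.inr ⟨l, hl, hFl⟩⟩ hT
    have hV : (⋂ j ∈ T, ⋂ l ∈ K (x.succAbove j), orAndCoin (A l) (sel i l) (F l))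
        = {z : α × Bool | z.1 ∈ ⋂ j ∈ T, ⋂ l ∈ K (x.succAbove j), A l} := by
      rw [show (⋂ j ∈ T, ⋂ l ∈ K (x.succAbove j), orAndCoin (A l) (sel i l) (F l))
          = ⋂ j ∈ T, {z : α × Bool | z.1 ∈ ⋂ l ∈ K (x.succAbove j), A l} from
        Set.iInter_congr fun j => Set.iInter_congr fun hj => slotLaw_plain A i F _ (hun j hj).1 (hun j hj).2]
      ext z; simp only [Set.mem_iInter, Set.mem_setOf_eq]
    rw [hV, ex_coin_phiLaw_inter μ A i (K x) _ h]

end SingleOrLaw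

end SahiMixture

end Summit.CriticalPhenomena.PercolationContinuityZ3.Theorems

end
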